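import Summits.ResolutionOfSingularities.ResolutionOfSingularities.Theses.DeepSandwich
import Literature.AlgebraicGeometry.Resolution.AffineBlowup
import Literature.AlgebraicGeometry.Resolution.AffineBlowupIntegral
import HarnessLib

/-!
# Radial core of the punctual blow-up problem — kernels for the `DeepSandwich` asides 28255–28260

Cell `decomp-res`, lens 4, generation 4 (node `RadialCore`, CRITIC-LEDGER row 30, 2026-08-30T04:54:00Z
«CLEARED AS CHILD NODE of DeepSandwich on the punctual core 25834»), filed by the route-writer as six
ASIDES of route `DeepSandwich` (rev 5): `HomogeneousBlowupResolve` (HBR, stmt-ResolutionOfSingularities-28255),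
`HomogeneousBlowupResolveLowDim` (HBR≤4 = THEOREM H, prover target, stmt-28256), `AffinePunctualResolve`
(APR, hub, stmt-28257), `WeightedHomogeneousBlowupResolve` (WHBR, stmt-28258), `TorusFreePunctualResolve`
(TFR, declared residual, stmt-28259), `PunctualTransfer` (T, stmt-28260); all refine the aside
`PunctualBlowupResolve` (PBR, stmt-25834).  Lens file: HOME/decomp-res-lens-4/g4/RadialCore.lean
sha256 561286c94b9c…; items VERBATIM items-radial.json sha256 b03f4e022c3a…; census data
HOME/census/COSTUME-CENSUS-v5.json sha256 53160be5c0c3….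

THE NEW ORDER PARAMETER is the radial torus on the punctual Hilbert scheme: a punctual ideal
`I ⊇ 𝔪^N` of `k[x₁..xₙ]` is radial-fixed (standard homogeneous), fixed by another diagonal `𝔾_m`
(weighted homogeneous for a non-constant integer weight), or torus-free.  This file proves, with 0 sorry:

* NECESSITY of every piece from ROOT (`homogeneousBlowupResolve_of_summit`, `weightedHomogeneousBlowupResolve_of_summit`,
  `affinePunctualResolve_of_summit`, `torusFreePunctualResolve_of_summit`, `punctualTransfer_of_summit`,
  `punctualBlowupResolve_of_summit`, `pieces_of_summit`), through the affine-blow-up plumbing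
  `hasResolution_affineBlowup_of_summit` (tree `affineBlowup`, `affineBlowup.isIntegral`);
* THE CASE SPLIT `affinePunctualResolve_of : HBR → WHBR → TFR → APR` (excluded middle twice, no absorption)
  and its exactness `affinePunctualResolve_iff_torusFree : HBR → WHBR → (APR ↔ TFR)`;
* the slices `lowDim_of_hbr : HBR → HBR≤4`, `torusFree_of_affine : APR → TFR`, `transfer_of_pbr : PBR → T`;
* THE NODE'S DECIDING KERNEL `punctualBlowupResolve_of_radial : HBR → WHBR → TFR → T → PBR` (PBR VERBATIM).

No statement is closed here (every item stays open); the file is by-name SUPPORT for the asides.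
-/

open AlgebraicGeometry CategoryTheory Literature.AlgebraicGeometry.Resolution

namespace Summit.ResolutionOfSingularities.ResolutionOfSingularities.Theses.DeepSandwich

/-- Affine-blow-up plumbing: ROOT resolves `Bl_J (Spec R)` for every finite-type `k`-domain `R` and
nonzero `J` (the blow-up is integral, proper over `Spec R`, hence separated, of finite type,
quasi-compact and reduced over `k`). -/
theorem hasResolution_affineBlowup_of_summit (h : _root_.ResolutionOfSingularities) {p : ℕ}
    (hp : p.Prime) (k : Type) [Field k] [CharP k p] (R : Type) [CommRing R] [IsDomain R]
    [Algebra k R] [Algebra.FiniteType k R] (J : Ideal R) (hJ : J ≠ ⊥) :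
    Scheme.HasResolution (affineBlowup J) := by
  haveI : IsNoetherianRing R := Algebra.FiniteType.isNoetherianRing k R
  haveI := affineBlowup.isIntegral hJ
  haveI : LocallyOfFiniteType (Spec.map (CommRingCat.ofHom (algebraMap k R))) :=
    (HasRingHomProperty.Spec_iff (P := @LocallyOfFiniteType)).mpr
      (RingHom.finiteType_algebraMap.mpr ‹_›)
  exact _root_.ResolutionOfSingularities_iff.mp h p hp k (affineBlowup J)
    (affineBlowup.π J ≫ Spec.map (CommRingCat.ofHom (algebraMap k R)))
    inferInstance inferInstance inferInstance inferInstance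

/-- NECESSITY of HBR (item 28255): ROOT ⟹ `HomogeneousBlowupResolve` (homogeneity is not used). -/
theorem homogeneousBlowupResolve_of_summit (h : _root_.ResolutionOfSingularities) :
    HomogeneousBlowupResolve := by
  intro p hp k _ _ n J hJ _
  exact hasResolution_affineBlowup_of_summit h hp k (MvPolynomial (Fin n) k) J hJ

/-- NECESSITY of WHBR (item 28258): ROOT ⟹ `WeightedHomogeneousBlowupResolve`. -/
theorem weightedHomogeneousBlowupResolve_of_summit (h : _root_.ResolutionOfSingularities) :
    WeightedHomogeneousBlowupResolve := by
  intro p hp k _ _ n J hJ _ _ _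
  exact hasResolution_affineBlowup_of_summit h hp k (MvPolynomial (Fin n) k) J hJ

/-- NECESSITY of APR (item 28257): ROOT ⟹ `AffinePunctualResolve`. -/
theorem affinePunctualResolve_of_summit (h : _root_.ResolutionOfSingularities) :
    AffinePunctualResolve := by
  intro p hp k _ _ n I hI _
  exact hasResolution_affineBlowup_of_summit h hp k (MvPolynomial (Fin n) k) I hI

/-- NECESSITY of PBR (item 25834): ROOT ⟹ `PunctualBlowupResolve` (compose `b ≫ g`). -/
theorem punctualBlowupResolve_of_summit (h : _root_.ResolutionOfSingularities) :
    PunctualBlowupResolve := by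
  intro p hp k _ _ Y g hg1 hg2 hg3 _ Γ b hb1 hb2 hb3 _ hΓ P _ _ _ _
  haveI := hg1; haveI := hg2; haveI := hg3; haveI := hb1; haveI := hb2; haveI := hb3; haveI := hΓ
  exact _root_.ResolutionOfSingularities_iff.mp h p hp k Γ (b ≫ g)
    inferInstance inferInstance inferInstance inferInstance

/-- HBR ⟹ HBR≤4 (item 28256 is a slice of item 28255). -/
theorem lowDim_of_hbr (hH : HomogeneousBlowupResolve) : HomogeneousBlowupResolveLowDim :=
  fun p hp k _ _ n _ J hJ hhom => hH p hp k n J hJ hhom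

/-- NECESSITY of HBR≤4 (item 28256): ROOT ⟹ `HomogeneousBlowupResolveLowDim`. -/
theorem homogeneousBlowupResolveLowDim_of_summit (h : _root_.ResolutionOfSingularities) :
    HomogeneousBlowupResolveLowDim :=
  lowDim_of_hbr (homogeneousBlowupResolve_of_summit h)

/-- APR ⟹ TFR (the residual 28259 is a sub-case of the hub 28257). -/
theorem torusFree_of_affine (hA : AffinePunctualResolve) : TorusFreePunctualResolve :=
  fun p hp k _ _ n I hI hN _ _ => hA p hp k n I hI hN

/-- NECESSITY of TFR (item 28259): ROOT ⟹ `TorusFreePunctualResolve`. -/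
theorem torusFreePunctualResolve_of_summit (h : _root_.ResolutionOfSingularities) :
    TorusFreePunctualResolve :=
  torusFree_of_affine (affinePunctualResolve_of_summit h)

/-- PBR ⟹ T (trivially: COSTUME-by-letter), hence NECESSITY of T (item 28260). -/
theorem transfer_of_pbr (hP : PunctualBlowupResolve) : PunctualTransfer :=
  fun _ => hP

/-- NECESSITY of T (item 28260): ROOT ⟹ `PunctualTransfer`. -/
theorem punctualTransfer_of_summit (h : _root_.ResolutionOfSingularities) : PunctualTransfer :=
  transfer_of_pbr (punctualBlowupResolve_of_summit h)

/-- THE CASE SPLIT on the punctual core (radial-fixed / other diagonal `𝔾_m` / torus-free):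
`HBR → WHBR → TFR → APR` — excluded middle twice, no absorption. -/
theorem affinePunctualResolve_of (hH : HomogeneousBlowupResolve)
    (hW : WeightedHomogeneousBlowupResolve) (hF : TorusFreePunctualResolve) :
    AffinePunctualResolve := by
  intro p hp k _ _ n I hI hN
  by_cases hhom : ∀ f ∈ I, ∀ d : ℕ, MvPolynomial.homogeneousComponent d f ∈ I
  · exact hH p hp k n I hI hhom
  by_cases hw : ∃ w : Fin n → ℤ, (¬ ∃ c : ℤ, w = fun _ => c) ∧
      ∀ f ∈ I, ∀ m : ℤ, MvPolynomial.weightedHomogeneousComponent w m f ∈ I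
  · obtain ⟨w, hwc, hst⟩ := hw
    exact hW p hp k n I hI w hwc hst
  · exact hF p hp k n I hI hN hhom hw

/-- Exactness at the hub, usable direction: given HBR and WHBR, `APR ⟺ TFR`. -/
theorem affinePunctualResolve_iff_torusFree (hH : HomogeneousBlowupResolve)
    (hW : WeightedHomogeneousBlowupResolve) :
    AffinePunctualResolve ↔ TorusFreePunctualResolve :=
  ⟨torusFree_of_affine, affinePunctualResolve_of hH hW⟩

/-- NECESSITY of all four pieces of the node (ROOT ⟹ pieces). -/
theorem pieces_of_summit (h : _root_.ResolutionOfSingularities) :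
    HomogeneousBlowupResolve ∧ WeightedHomogeneousBlowupResolve ∧ TorusFreePunctualResolve ∧
      PunctualTransfer :=
  ⟨homogeneousBlowupResolve_of_summit h, weightedHomogeneousBlowupResolve_of_summit h,
    torusFreePunctualResolve_of_summit h, punctualTransfer_of_summit h⟩

/-- THE NODE'S DECIDING KERNEL (pieces ⟹ `PunctualBlowupResolve` VERBATIM, 0 sorry, every hypothesis
load-bearing): the radial-fixed locus (Theorem H for `n ≤ 4`), the other diagonal tori (torus-descent
port), the torus-free residual, and the transfer from coordinates to germs. -/
theorem punctualBlowupResolve_of_radial (hH : HomogeneousBlowupResolve)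
    (hW : WeightedHomogeneousBlowupResolve) (hF : TorusFreePunctualResolve) (hTr : PunctualTransfer) :
    PunctualBlowupResolve :=
  hTr (affinePunctualResolve_of hH hW hF)

end Summit.ResolutionOfSingularities.ResolutionOfSingularities.Theses.DeepSandwich
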